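import Summits.ValiantsHypothesis.ValiantsHypothesis.Theorems.TwistedDetRankSliceVPInVBPCalibration
import Summits.ValiantsHypothesis.ValiantsHypothesis.Theorems.TwistedDetRankFermionicNormalFormLocalGenerators
import Summits.ValiantsHypothesis.ValiantsHypothesis.Theorems.TwistedDetRankFermionicNormalFormSummitHard
import Summits.ValiantsHypothesis.ValiantsHypothesis.Theorems.BorderApolarityFixedWitnessObstructionQPDeborder
import Literature.Computability.AlgebraicComplexity.VBPDeterminantalComplexity
import Literature.Computability.AlgebraicComplexity.BLMW11FormulasWeaklySkew
import Literature.Computability.AlgebraicComplexity.ABV17SingularLocusBound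

/-!
# `TwistedDetRank.SliceVPInVBP` (stmt-ValiantsHypothesis-17992, X2a) — the tdr → dc bridge and
# the sub-slice on which X2a is verified today

X2a: a p-computable class-function GMF family `f_n = Σ_σ χ_n(σ) Π_i X_{σ(i),i}` has affine
determinantal representations of p-bounded size.  The first prover's calibration
(`TwistedDetRankSliceVPInVBPCalibration`, p551099/p552122) shows X2a is locked between two named
open problems.  This file adds the elementary, unconditional link that the route file lists under
"NOT DECOMPOSED YET" ("sum of `r` twisted `n × n` determinants has `dc ≤ poly(r, n)`") and draws the
consequences for X2a:

* §1 `hasDetRepr_twistedDet`, `hasDetRepr_sum_twistedDet` — a Hadamard-twisted determinant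
  `det(X ∘ E)` is a homogeneous affine determinant of size `n`; a sum of `r` of them has an affine
  determinantal representation of size `r · 2(n+1)^9 + 1` (tree: inverse read-outs of homogeneous
  determinants, `stub_invReprOfDetRepr`, sizes add, border).
* §2 `polyDc_of_polyTdr` — polynomial twisted-determinantal rank ⇒ polynomial `dc` (family form);
  `sliceVPInVBP_of_polyTdr` — the POLYNOMIAL form of the route's normal-form crux X2
  (`FermionicNormalForm` with `n^c + c` in place of `2^((log₂ n + c)^c)`) implies X2a; it also
  implies X2 (`fermionicNormalForm_of_polyTdr`) and X2b (`sliceVBPFermionic_of_polyTdr`, §3), so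
  this one (summit-hard) statement sits above all three open binders of the route's `closes`.
* §3 `exists_twistedDetSum_of_local`, `hasDetRepr_gmf_of_local`, `polyDc_of_local` — the LOCAL
  sub-slice (class functions that are, for each `n ≥ 1`, combinations of `≤ n^d + d` local generators
  of weight `≤ w`, `w` FIXED; tree `IsLocalGenerator`, the landed construction half
  `stub_localGeneratorsSmallTdr` of line `registered` of crux X2) has polynomial `dc`
  UNCONDITIONALLY, and is p-computable (`isPComputable_of_polyDc`): on it both the hypothesis and
  the conclusion of X2a hold — this is the precise content of the item's sentence "every
  class-function GMF known to be in VP is a short twisted-determinant sum and has polynomial dc".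
* §4 `sliceVPInVBP_of_vp_subset_vpws` — X2a is implied by `VP ⊆ VP_ws` for families in the
  variables `Fin n × Fin n` (the standard residual "`VP = VBP`"); with the calibration file this
  places X2a between `VP ⊆ VP_ws` (above) and the weak⇒strong transfer (below).

HONEST FRAMING: nothing here proves or refutes X2a (director-valiant ruled it the route's RESIDUAL,
2026-08-27); the p-computability hypothesis of X2a is idle in §3.  `VP ≠ VNP` is not moved.

References: Valiant 1979; Malod–Portier 2008 Thm 6/8; Bürgisser 2000 §2.5, §7.1;
Marcus–Minc 1961; BLMW 2011 §9.1–9.2.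
-/

-- single-conjunct layout: Sub = Summit, duplicated namespace component intended
set_option linter.dupNamespace false

noncomputable section

namespace Summit.ValiantsHypothesis.ValiantsHypothesis.Theorems.TwistedDetRankSliceVPInVBP

open MvPolynomial Literature.Computability.AlgebraicComplexity
open Summit.ValiantsHypothesis.ValiantsHypothesis.Theses.TwistedDetRank
open Summit.ValiantsHypothesis.ValiantsHypothesis.Theorems.TwistedDetRankFermionicNormalForm
  (IsLocalGenerator stub_localGeneratorsSmallTdr gmf_eq_of_repr repr_of_gmf_eq cone_lincomb)
open scoped BigOperators

/-! ## §1 A twisted determinant is a homogeneous affine determinant; sums -/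

/-- The entries `E_{ij} · X_{ij}` of a Hadamard-twisted generic matrix are linear forms. [folklore] -/
theorem twistedDet_entry_isHomogeneous {n : ℕ} (E : Matrix (Fin n) (Fin n) ℂ) (i j : Fin n) :
    ((Matrix.of fun i j => C (E i j) * (X (i, j) : MvPolynomial (Fin n × Fin n) ℂ)) i j).IsHomogeneous 1 := by
  rw [Matrix.of_apply]
  simpa using (isHomogeneous_C (Fin n × Fin n) (E i j)).mul (isHomogeneous_X ℂ (i, j))

/-- A twisted determinant `det(X ∘ E)` is a form of degree `n`. [folklore] -/
theorem twistedDet_isHomogeneous {n : ℕ} (E : Matrix (Fin n) (Fin n) ℂ) :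
    ((Matrix.of fun i j => C (E i j) * (X (i, j) : MvPolynomial (Fin n × Fin n) ℂ)).det).IsHomogeneous n := by
  simpa only [Fintype.card_fin] using
    AlperBogartVelasco.isHomogeneous_det_of_linear _ (twistedDet_entry_isHomogeneous E)

/-- A twisted determinant `det(X ∘ E)` of an `n × n` matrix has an affine determinantal
representation of size `n` (itself). [cite: MignonRessayre2004, §1] -/
theorem hasDetRepr_twistedDet {n : ℕ} (E : Matrix (Fin n) (Fin n) ℂ) :
    HasDetRepr ((Matrix.of fun i j => C (E i j) * (X (i, j) : MvPolynomial (Fin n × Fin n) ℂ)).det) n :=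
  ⟨_, fun i j => (twistedDet_entry_isHomogeneous E i j).totalDegree_le, rfl⟩

/-- **tdr → dc, single size**: a sum of `r` twisted determinants of `n × n` matrices has an affine
determinantal representation of size `r · 2(n+1)^9 + 1` (each summand is a form of degree `n` with
`dc ≤ n`, so an inverse read-out of size `2(n+1)^9`, tree `stub_invReprOfDetRepr`; read-outs add,
`HasInvRepr.finset_sum`; border, `HasInvRepr.hasDetRepr` — packaged as
`hasDetRepr_sum_of_isHomogeneous`). [folklore; Valiant1979, MalodPortier2008 Thm 6] -/
theorem hasDetRepr_sum_twistedDet {n r : ℕ} (E : Fin r → Matrix (Fin n) (Fin n) ℂ) :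
    HasDetRepr (∑ t, (Matrix.of fun i j => C (E t i j) * (X (i, j) : MvPolynomial (Fin n × Fin n) ℂ)).det)
      (r * (2 * (n + 1) ^ 9) + 1) := by
  have h := BorderApolarityFixedWitnessObstructionQP.hasDetRepr_sum_of_isHomogeneous
    (Finset.univ : Finset (Fin r))
    (fun t => (Matrix.of fun i j => C (E t i j) * (X (i, j) : MvPolynomial (Fin n × Fin n) ℂ)).det)
    n n (fun t _ => twistedDet_isHomogeneous (E t)) (fun t _ => hasDetRepr_twistedDet (E t))
  simpa only [Finset.card_univ, Fintype.card_fin] using h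

/-! ## §2 Polynomial tdr gives polynomial dc; the polynomial normal form gives X2a -/

/-- The size bound `(n^c + c) · 2(n+1)^9 + 1` is p-bounded. [folklore] -/
theorem isPBounded_tdrDcBound (c : ℕ) :
    IsPBounded fun n => (n ^ c + c) * (2 * (n + 1) ^ 9) + 1 :=
  IsPBounded.add_holds (IsPBounded.mul_holds
    (IsPBounded.add_holds (IsPBounded.pow_holds IsPBounded.id c) (IsPBounded.const c))
    (IsPBounded.mul_holds (IsPBounded.const 2)
      (IsPBounded.pow_holds (IsPBounded.add_holds IsPBounded.id (IsPBounded.const 1)) 9)))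
    (IsPBounded.const 1)

/-- A polynomial of total degree `≤ 1` is its own `1 × 1` affine determinantal representation.
[cite: MignonRessayre2004, §1] -/
theorem hasDetRepr_one_of_totalDegree_le_one {σ : Type*} (p : MvPolynomial σ ℂ)
    (hp : p.totalDegree ≤ 1) : HasDetRepr p 1 :=
  ⟨Matrix.of fun _ _ => p, fun _ _ => hp, by rw [Matrix.det_fin_one, Matrix.of_apply]⟩

/-- At `n = 0` the slice polynomial is the constant `χ(1)`. [folklore] -/
theorem gmf_fin_zero (χ : Equiv.Perm (Fin 0) → ℂ) :
    (∑ σ : Equiv.Perm (Fin 0), C (χ σ) *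
        ∏ i : Fin 0, (X (σ i, i) : MvPolynomial (Fin 0 × Fin 0) ℂ)) = C (χ 1) := by
  simp [Equiv.Perm.default_eq]

/-- At `n = 0` the slice polynomial has an affine determinantal representation of size `1`.
[folklore] -/
theorem hasDetRepr_gmf_fin_zero (χ : Equiv.Perm (Fin 0) → ℂ) :
    HasDetRepr (∑ σ : Equiv.Perm (Fin 0), C (χ σ) *
        ∏ i : Fin 0, (X (σ i, i) : MvPolynomial (Fin 0 × Fin 0) ℂ)) 1 := by
  rw [gmf_fin_zero]
  exact hasDetRepr_one_of_totalDegree_le_one _ (by rw [totalDegree_C]; exact Nat.zero_le _)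

/-- **tdr → dc, family form**: if `f_n` is, for every `n ≥ 1`, a sum of at most `n^c + c` twisted
`n × n` determinants, and `f_0` is affine, then `f` has affine determinantal representations of
p-bounded size. [folklore; Valiant1979, MalodPortier2008 Thm 6] -/
theorem polyDc_of_polyTdr (f : (n : ℕ) → MvPolynomial (Fin n × Fin n) ℂ)
    (h0 : (f 0).totalDegree ≤ 1)
    (h : ∃ c : ℕ, ∀ n : ℕ, 1 ≤ n → ∃ r ≤ n ^ c + c, ∃ E : Fin r → Matrix (Fin n) (Fin n) ℂ,
      f n = ∑ t, (Matrix.of fun i j => C (E t i j) * (X (i, j) : MvPolynomial (Fin n × Fin n) ℂ)).det) :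
    ∃ c : ℕ, ∀ n : ℕ, ∃ m ≤ n ^ c + c, HasDetRepr (f n) m := by
  obtain ⟨c, hc⟩ := h
  obtain ⟨c', hc'⟩ := isPBounded_tdrDcBound c
  refine ⟨c', fun n => ⟨(n ^ c + c) * (2 * (n + 1) ^ 9) + 1, hc' n, ?_⟩⟩
  rcases Nat.eq_zero_or_pos n with rfl | hn
  · exact HasDetRepr.mono_holds (hasDetRepr_one_of_totalDegree_le_one _ h0) (Nat.le_add_left 1 _)
  · obtain ⟨r, hr, E, hE⟩ := hc n hn
    rw [hE]
    exact HasDetRepr.mono_holds (hasDetRepr_sum_twistedDet E) (by gcongr)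

/-- **The polynomial normal form implies X2a**: if every p-computable class-function GMF family
is, for `n ≥ 1`, a sum of POLYNOMIALLY many twisted determinants (the `n^c + c` strengthening of
the route's crux `FermionicNormalForm`), then `SliceVPInVBP`.  (The strengthening is itself at
least summit-hard, since `FermionicNormalForm → ValiantsHypothesis`,
`valiantsHypothesis_of_fermionicNormalForm`; recorded for the route's bookkeeping.)
[this file; Burgisser2000 §7.1] -/
theorem sliceVPInVBP_of_polyTdr
    (h : ∀ χ : (n : ℕ) → Equiv.Perm (Fin n) → ℂ,
      (∀ (n : ℕ) (σ τ : Equiv.Perm (Fin n)), χ n (τ * σ * τ⁻¹) = χ n σ) →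
      IsPComputable (fun n => ∑ σ : Equiv.Perm (Fin n),
        C (χ n σ) * ∏ i : Fin n, (X (σ i, i) : MvPolynomial (Fin n × Fin n) ℂ)) →
      ∃ c : ℕ, ∀ n : ℕ, 1 ≤ n → ∃ r ≤ n ^ c + c, ∃ E : Fin r → Matrix (Fin n) (Fin n) ℂ,
        (∑ σ : Equiv.Perm (Fin n),
            C (χ n σ) * ∏ i : Fin n, (X (σ i, i) : MvPolynomial (Fin n × Fin n) ℂ)) =
          ∑ t, (Matrix.of fun i j => C (E t i j) * X (i, j)).det) :
    SliceVPInVBP := fun χ hχ hc =>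
  polyDc_of_polyTdr _ (by rw [gmf_fin_zero, totalDegree_C]; exact Nat.zero_le _) (h χ hχ hc)

/-- **The polynomial normal form also implies the route's crux X2 (`FermionicNormalForm`)**:
`n^c + c ≤ 2^((log₂ n + c')^c')` (`IsPBounded.isQPBounded`). [this file] -/
theorem fermionicNormalForm_of_polyTdr
    (h : ∀ χ : (n : ℕ) → Equiv.Perm (Fin n) → ℂ,
      (∀ (n : ℕ) (σ τ : Equiv.Perm (Fin n)), χ n (τ * σ * τ⁻¹) = χ n σ) →
      IsPComputable (fun n => ∑ σ : Equiv.Perm (Fin n),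
        C (χ n σ) * ∏ i : Fin n, (X (σ i, i) : MvPolynomial (Fin n × Fin n) ℂ)) →
      ∃ c : ℕ, ∀ n : ℕ, 1 ≤ n → ∃ r ≤ n ^ c + c, ∃ E : Fin r → Matrix (Fin n) (Fin n) ℂ,
        (∑ σ : Equiv.Perm (Fin n),
            C (χ n σ) * ∏ i : Fin n, (X (σ i, i) : MvPolynomial (Fin n × Fin n) ℂ)) =
          ∑ t, (Matrix.of fun i j => C (E t i j) * X (i, j)).det) :
    FermionicNormalForm := by
  intro χ hχ hc
  obtain ⟨c, hcr⟩ := h χ hχ hc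
  obtain ⟨c', hc'⟩ := IsPBounded.isQPBounded (t := fun n => n ^ c + c)
    (IsPBounded.add_holds (IsPBounded.pow_holds IsPBounded.id c) (IsPBounded.const c))
  refine ⟨c', fun n hn => ?_⟩
  obtain ⟨r, hr, E, hE⟩ := hcr n hn
  exact ⟨r, hr.trans (hc' n), E, hE⟩

/-! ## §3 The local sub-slice: polynomial dc unconditionally, and p-computable -/

/-- A combination of `k` local generators of weight `≤ w` on `S_n`, `n ≥ 1`, is (the coefficient
function of) a sum of `k · (n+1)^(w+1)` twisted determinants: stub B of line `registered`
(`stub_localGeneratorsSmallTdr`) for each generator, scalars absorbed and the sums concatenated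
(`cone_lincomb`). [Burgisser2000 §7.1; MarcusMinc1961] -/
theorem exists_twistedDetSum_of_local {n w k : ℕ} (hn : 1 ≤ n) (a : Fin k → ℂ)
    (g : Fin k → Equiv.Perm (Fin n) → ℂ) (hg : ∀ t, IsLocalGenerator n w (g t)) :
    ∃ E : Fin (k * (n + 1) ^ (w + 1)) → Matrix (Fin n) (Fin n) ℂ,
      (∑ σ : Equiv.Perm (Fin n), C ((∑ t, a t • g t) σ) *
          ∏ i : Fin n, (X (σ i, i) : MvPolynomial (Fin n × Fin n) ℂ)) =
        ∑ s, (Matrix.of fun i j => C (E s i j) * X (i, j)).det := by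
  choose E hE using fun t => stub_localGeneratorsSmallTdr n w (g t) hn (hg t)
  have hcoef : ∀ t σ, g t σ = ∑ s, ((Equiv.Perm.sign σ : ℤ) : ℂ) * ∏ i, E t s (σ i) i :=
    fun t σ => repr_of_gmf_eq (g t) (E t) (hE t) σ
  obtain ⟨E', hE'⟩ := cone_lincomb hn a g E hcoef
  refine ⟨E', gmf_eq_of_repr _ E' fun σ => ?_⟩
  rw [← hE' σ, Finset.sum_apply]
  simp only [Pi.smul_apply, smul_eq_mul]

/-- **Polynomial dc on the local sub-slice, single `n`**: the GMF of a combination of `k` local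
generators of weight `≤ w` on `S_n`, `n ≥ 1`, has an affine determinantal representation of size
`k (n+1)^(w+1) · 2(n+1)^9 + 1`. [this file] -/
theorem hasDetRepr_gmf_of_local {n w k : ℕ} (hn : 1 ≤ n) (a : Fin k → ℂ)
    (g : Fin k → Equiv.Perm (Fin n) → ℂ) (hg : ∀ t, IsLocalGenerator n w (g t)) :
    HasDetRepr (∑ σ : Equiv.Perm (Fin n), C ((∑ t, a t • g t) σ) *
        ∏ i : Fin n, (X (σ i, i) : MvPolynomial (Fin n × Fin n) ℂ))
      (k * (n + 1) ^ (w + 1) * (2 * (n + 1) ^ 9) + 1) := by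
  obtain ⟨E, hE⟩ := exists_twistedDetSum_of_local hn a g hg
  rw [hE]
  exact hasDetRepr_sum_twistedDet E

/-- The size bound `(n^d + d)(n+1)^(w+1) · 2(n+1)^9 + 1` is p-bounded (for FIXED `w`). [folklore] -/
theorem isPBounded_localDcBound (d w : ℕ) :
    IsPBounded fun n => (n ^ d + d) * (n + 1) ^ (w + 1) * (2 * (n + 1) ^ 9) + 1 :=
  IsPBounded.add_holds (IsPBounded.mul_holds (IsPBounded.mul_holds
    (IsPBounded.add_holds (IsPBounded.pow_holds IsPBounded.id d) (IsPBounded.const d))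
    (IsPBounded.pow_holds (IsPBounded.add_holds IsPBounded.id (IsPBounded.const 1)) (w + 1)))
    (IsPBounded.mul_holds (IsPBounded.const 2)
      (IsPBounded.pow_holds (IsPBounded.add_holds IsPBounded.id (IsPBounded.const 1)) 9)))
    (IsPBounded.const 1)

/-- **X2a's conclusion holds unconditionally on the LOCAL sub-slice**: if, for some fixed weight
`w` and exponent `d`, each `χ_n` (`n ≥ 1`) is a combination of at most `n^d + d` local generators of
weight `≤ w`, then the GMF family of `χ` has affine determinantal representations of p-bounded size
— with NO computability hypothesis.  (All class functions with a known polynomial-dc GMF are of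
this kind: `sgn · F(c₁) · Π_{j ∈ m} c_j` and functions of the cycle type supported on permutations
moving `≤ w` points; Bürgisser 2000 §7.1.) [this file] -/
theorem polyDc_of_local (χ : (n : ℕ) → Equiv.Perm (Fin n) → ℂ) (w d : ℕ)
    (hloc : ∀ n : ℕ, 1 ≤ n → ∃ k ≤ n ^ d + d, ∃ (a : Fin k → ℂ) (g : Fin k → Equiv.Perm (Fin n) → ℂ),
      (∀ t, IsLocalGenerator n w (g t)) ∧ χ n = ∑ t, a t • g t) :
    ∃ c : ℕ, ∀ n : ℕ, ∃ m ≤ n ^ c + c,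
      HasDetRepr (∑ σ : Equiv.Perm (Fin n), C (χ n σ) *
        ∏ i : Fin n, (X (σ i, i) : MvPolynomial (Fin n × Fin n) ℂ)) m := by
  obtain ⟨c', hc'⟩ := isPBounded_localDcBound d w
  refine ⟨c', fun n => ⟨(n ^ d + d) * (n + 1) ^ (w + 1) * (2 * (n + 1) ^ 9) + 1, hc' n, ?_⟩⟩
  rcases Nat.eq_zero_or_pos n with rfl | hn
  · exact HasDetRepr.mono_holds (hasDetRepr_gmf_fin_zero (χ 0)) (Nat.le_add_left 1 _)
  · obtain ⟨k, hk, a, g, hg, hχ⟩ := hloc n hn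
    rw [hχ]
    exact HasDetRepr.mono_holds (hasDetRepr_gmf_of_local hn a g hg) (by gcongr)

/-- **Polynomial dc on the slice gives p-computability** (`VBP ⊆ VP` for families in the `n²`
variables `Fin n × Fin n`: p-bounded `dc` ⇒ `VP_ws` ⇒ `VP` ⇒ p-computable;
`isVPwsFamily_of_isPBounded_determinantalComplexity`, `IsVPwsFamily.isVPFamily`). So on the local
sub-slice BOTH the hypothesis and the conclusion of X2a hold. [cite: BurgisserEtAl2011, §9.1–9.2] -/
theorem isPComputable_of_polyDc (f : (n : ℕ) → MvPolynomial (Fin n × Fin n) ℂ)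
    (h : ∃ c : ℕ, ∀ n : ℕ, ∃ m ≤ n ^ c + c, HasDetRepr (f n) m) : IsPComputable f := by
  have hσ : IsPBounded fun n => Fintype.card (Fin n × Fin n) :=
    IsPBounded.mono (IsPBounded.mul_holds IsPBounded.id IsPBounded.id) fun n => by simp
  obtain ⟨c, hc⟩ := h
  have hdc : IsPBounded fun n => determinantalComplexity (f n) := by
    refine IsPBounded.mono (t := fun n => n ^ c + c)
      (IsPBounded.add_holds (IsPBounded.pow_holds IsPBounded.id c) (IsPBounded.const c)) fun n => ?_
    obtain ⟨m, hm, hA⟩ := hc n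
    exact (determinantalComplexity_le_of_hasDetRepr hA).trans hm
  exact ((isVPwsFamily_of_isPBounded_determinantalComplexity hσ hdc).isVPFamily hσ).2

/-- **The polynomial normal form also implies X2b (`SliceVBPFermionic`)**: a slice family with
p-bounded `dc` is p-computable (`isPComputable_of_polyDc`), so the polynomial normal form applies,
and `n^c + c ≤ 2^((log₂ n + c')^c')`.  Hence the single statement "p-computable class-function
GMFs have POLYNOMIAL tdr" implies all three open binders X2a, X2b, X2 of the route's `closes`
(and is at least summit-hard). [this file] -/
theorem sliceVBPFermionic_of_polyTdr
    (h : ∀ χ : (n : ℕ) → Equiv.Perm (Fin n) → ℂ,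
      (∀ (n : ℕ) (σ τ : Equiv.Perm (Fin n)), χ n (τ * σ * τ⁻¹) = χ n σ) →
      IsPComputable (fun n => ∑ σ : Equiv.Perm (Fin n),
        C (χ n σ) * ∏ i : Fin n, (X (σ i, i) : MvPolynomial (Fin n × Fin n) ℂ)) →
      ∃ c : ℕ, ∀ n : ℕ, 1 ≤ n → ∃ r ≤ n ^ c + c, ∃ E : Fin r → Matrix (Fin n) (Fin n) ℂ,
        (∑ σ : Equiv.Perm (Fin n),
            C (χ n σ) * ∏ i : Fin n, (X (σ i, i) : MvPolynomial (Fin n × Fin n) ℂ)) =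
          ∑ t, (Matrix.of fun i j => C (E t i j) * X (i, j)).det) :
    SliceVBPFermionic := by
  intro χ hχ hdc
  obtain ⟨c, hcr⟩ := h χ hχ (isPComputable_of_polyDc _ hdc)
  obtain ⟨c', hc'⟩ := IsPBounded.isQPBounded (t := fun n => n ^ c + c)
    (IsPBounded.add_holds (IsPBounded.pow_holds IsPBounded.id c) (IsPBounded.const c))
  refine ⟨c', fun n hn => ?_⟩
  obtain ⟨r, hr, E, hE⟩ := hcr n hn
  exact ⟨r, hr.trans (hc' n), E, hE⟩

/-- **The local sub-slice lies in `VP ∩ VBP`**: under the hypothesis of `polyDc_of_local` the GMF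
family is p-computable and has p-bounded `dc`; in particular X2a holds for it (hypothesis and
conclusion both true). [this file] -/
theorem sliceVPInVBP_verified_on_local (χ : (n : ℕ) → Equiv.Perm (Fin n) → ℂ) (w d : ℕ)
    (hloc : ∀ n : ℕ, 1 ≤ n → ∃ k ≤ n ^ d + d, ∃ (a : Fin k → ℂ) (g : Fin k → Equiv.Perm (Fin n) → ℂ),
      (∀ t, IsLocalGenerator n w (g t)) ∧ χ n = ∑ t, a t • g t) :
    IsPComputable (fun n => ∑ σ : Equiv.Perm (Fin n), C (χ n σ) *
        ∏ i : Fin n, (X (σ i, i) : MvPolynomial (Fin n × Fin n) ℂ)) ∧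
      ∃ c : ℕ, ∀ n : ℕ, ∃ m ≤ n ^ c + c,
        HasDetRepr (∑ σ : Equiv.Perm (Fin n), C (χ n σ) *
          ∏ i : Fin n, (X (σ i, i) : MvPolynomial (Fin n × Fin n) ℂ)) m :=
  ⟨isPComputable_of_polyDc _ (polyDc_of_local χ w d hloc), polyDc_of_local χ w d hloc⟩

/-! ## §4 X2a is implied by `VP ⊆ VP_ws` -/

/-- **`VP ⊆ VP_ws` (on the variables `Fin n × Fin n`) implies X2a**: a p-computable class-function
GMF family is a `VP` family (`isVPFamily_gmf_of_isPComputable`); if it is in `VP_ws` then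
`dc ≤ 12 L_ws + 1` is p-bounded (`hasDetRepr_of_wsComplexity_le`).  Together with
`valiantsHypothesis_of_sliceVPInVBP_of_dcPerSuperpolynomial` this places X2a between the standard
statements `VP ⊆ VP_ws` (above it) and the weak⇒strong transfer
`DcPerSuperpolynomial ℂ → ValiantsHypothesis` (below it).  The class-function hypothesis is not
used. [cite: MalodPortier2008, Thm 6 and Thm 8; BurgisserEtAl2011, §9.2] -/
theorem sliceVPInVBP_of_vp_subset_vpws
    (h : ∀ f : (n : ℕ) → MvPolynomial (Fin n × Fin n) ℂ, IsVPFamily f → IsVPwsFamily f) :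
    SliceVPInVBP := by
  intro χ _hχ hc
  obtain ⟨c, hcws⟩ := h _ (isVPFamily_gmf_of_isPComputable χ hc)
  obtain ⟨c', hc'⟩ := isPBounded_twelve_mul_add_one c
  exact ⟨c', fun n => ⟨3 * (4 * (n ^ c + c)) + 1, hc' n, hasDetRepr_of_wsComplexity_le _ (hcws n)⟩⟩

end Summit.ValiantsHypothesis.ValiantsHypothesis.Theorems.TwistedDetRankSliceVPInVBP

end
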